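import Summits.KontsevichZagierPeriods.KontsevichZagierPeriods.Theorems.PlanarAreas.Negative.Core
import Summits.KontsevichZagierPeriods.KontsevichZagierPeriods.Theorems.PlanarSAZylev.Negative.Kit
import Literature.NumberTheory.Transcendental.KZSubcalculusInvariants

/-!
# `PlanarAreas` (stmt-KontsevichZagierPeriods-4990): negative side — II. refuted strengthenings

* §3 `not_oneMoveNoNull`: the Monge form WITHOUT its null-set clause ("equal area ⇒ ONE
  change-of-variables move") is false — `[(0,1)², 1]` versus `[[0,1]², 1]`: a differentiable
  injective `Φ` with `|det DΦ| = 1` on the open square cannot reach the corner `0` (the first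
  coordinate of `Φ` would have an interior minimum, `IsLocalMin.hasFDerivAt_eq_zero`, contradicting
  `det ≠ 0`).  So PlanarTransport's "discard null sets" and TransportToGroup's `[N] = [N] + [N]`
  bookkeeping are load-bearing.  Bookkeeping lemma of independent use:
  `exists_witness_of_mem_changeOfVariablesRel` (an actual witness `Φ, Φ'` from `r` onto `r'` out of
  a membership `[r] − [r'] ∈ changeOfVariablesRel`), via `of_sub_of_eq_of_sub_of`.
* §3b `not_additivityOnly`: chains of rules 1a/1b alone do not relate `(0,1)²` to its translate
  (the tree's window invariant `KZ.restrictedEval`): every chain for the crux contains a rule-2 or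
  a rule-3 move.  (`Rule2LoadBearing.lean` sharpens this: a rule-2 move is needed.)

REPAIR 2026-08-19 (cell pub-kz1p, seat b2b-kz1p-1; import + open line, NO statement, proof or declaration text changed):
`PlanarTransport` was dropped from `Theses/SymplecticScissors.lean` by the items-cap lint autofix of 2026-08-16T14:16:23Z
and re-homed, with the item's registered signature verbatim, as
`Summit.KontsevichZagierPeriods.SymplecticScissors.PlanarTransport` in `Theorems/PlanarSAZylev/Negative/Kit.lean`; this
file (which uses it in `oneMoveNoNull_le_planarTransport`) now imports that kit and opens the name from there instead of
from the route namespace, where it no longer exists (the module did not elaborate at HEAD). -/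

noncomputable section

open Set MeasureTheory MvPolynomial Filter Topology
open Literature.NumberTheory.Transcendental Literature.ModelTheory.ExponentialFields

namespace Summit.KontsevichZagierPeriods.PlanarAreas.Negative

open Summit.KontsevichZagierPeriods.KontsevichZagierPeriods.Theses.SymplecticScissors
  (PlanarAreas VolumeForm PlanarK0Injective GroupToAreas)
open Summit.KontsevichZagierPeriods.SymplecticScissors (PlanarTransport)

/-! ## §3 A refuted strengthening: ONE move, no null sets -/

/-- Bookkeeping in a free abelian group: `of a − of b = of c − of d` with `a ≠ b` forces
`a = c` and `b = d`. -/
theorem of_sub_of_eq_of_sub_of {X : Type*} {a b c d : X}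
    (h : FreeAbelianGroup.of a - FreeAbelianGroup.of b =
      FreeAbelianGroup.of c - FreeAbelianGroup.of d) (hab : a ≠ b) : a = c ∧ b = d := by
  classical
  have h' : FreeAbelianGroup.of a + FreeAbelianGroup.of d =
      FreeAbelianGroup.of c + FreeAbelianGroup.of b := sub_eq_sub_iff_add_eq_add.mp h
  have key := congrArg FreeAbelianGroup.toFinsupp h'
  simp only [map_add, FreeAbelianGroup.toFinsupp_of] at key
  rcases (Finsupp.single_add_single_eq_single_add_single one_ne_zero one_ne_zero).mp key with
    ⟨hac, hdb⟩ | ⟨-, hab', -⟩ | ⟨h2, -, -⟩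
  · exact ⟨hac, hdb.symm⟩
  · exact absurd hab' hab
  · norm_num at h2

/-- **Unpacking a single change-of-variables move.** If `[r] − [r'] ∈ changeOfVariablesRel` and
`r.domain ≠ r'.domain`, then the existential witness of the move relates `r` to `r'` themselves:
a `ℚ`-semialgebraic `Φ`, differentiable within and injective on `r.domain`, with
`r'.domain = Φ '' r.domain` exactly and `r.integrand x = r'.integrand (Φ x) · |det Φ' x|`. -/
theorem exists_witness_of_mem_changeOfVariablesRel {n : ℕ} {r r' : KZ.IntegralRep n}
    (hne : r.domain ≠ r'.domain) (h : KZ.of r - KZ.of r' ∈ KZ.changeOfVariablesRel) :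
    ∃ (Φ : (Fin n → ℝ) → (Fin n → ℝ)) (Φ' : (Fin n → ℝ) → (Fin n → ℝ) →L[ℝ] (Fin n → ℝ)),
      IsSemialgebraicMapOn ℚ r.domain Φ ∧
      (∀ x ∈ r.domain, HasFDerivWithinAt Φ (Φ' x) r.domain x) ∧
      InjOn Φ r.domain ∧ r'.domain = Φ '' r.domain ∧
      (∀ x ∈ r.domain, r.integrand x = r'.integrand (Φ x) * |(Φ' x).det|) := by
  obtain ⟨m, s, s', Φ, Φ', hΦ, hd, hinj, hdom, hf, heq⟩ := h
  have hne' : (⟨n, r⟩ : Σ k, KZ.IntegralRep k) ≠ ⟨n, r'⟩ := by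
    intro h
    cases h
    exact hne rfl
  obtain ⟨h1, h2⟩ := of_sub_of_eq_of_sub_of (X := Σ k, KZ.IntegralRep k) heq hne'
  cases h1
  cases h2
  exact ⟨Φ, Φ', hΦ, hd, hinj, hdom, hf⟩

/-- STRENGTHENING: equal-area integrand-`1` planar representations differ by ONE
change-of-variables move — the Monge form `PlanarTransport` with its null-set clause
(`s ⊆ r`, `volume (r ∖ s) = 0`, …) deleted. -/
def OneMoveNoNull : Prop :=
  ∀ (r r' : KZ.IntegralRep 2), (∀ p ∈ r.domain, r.integrand p = 1) →
    (∀ p ∈ r'.domain, r'.integrand p = 1) → r.value = r'.value →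
    KZ.of r - KZ.of r' ∈ KZ.changeOfVariablesRel

/-- `PlanarTransport` trivially implies the strengthening's conclusion AFTER restriction; the
point of `not_oneMoveNoNull` is that the restriction cannot be omitted. -/
theorem oneMoveNoNull_le_planarTransport (h : OneMoveNoNull) : PlanarTransport := by
  intro r r' hr hr' hv
  exact ⟨r, r', subset_rfl, by simp, subset_rfl, by simp, hr, hr', h r r' hr hr' hv⟩

/-- **The no-null-set Monge form is false**: `[(0,1)², 1]` and `[[0,1]², 1]` have equal area `1`
but are not ONE change of variables apart.  If `Φ` were the witness (differentiable on the open
square `S`, `|det DΦ| = 1` there because both integrands are `1`, `Φ '' S = [0,1]²`), pick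
`x₀ ∈ S` with `Φ x₀ = 0`; the first coordinate `x ↦ Φ x 0` is `≥ 0` on `S` and `= 0` at the
interior point `x₀`, so its derivative `e₀* ∘ DΦ(x₀)` vanishes (`IsLocalMin.hasFDerivAt_eq_zero`),
contradicting the surjectivity of `DΦ(x₀)` (`det ≠ 0`). -/
theorem not_oneMoveNoNull : ¬ OneMoveNoNull := by
  intro h
  have hmem := h openSquare closedSquare (fun _ _ => rfl) (fun _ _ => rfl)
    (by rw [value_openSquare, value_closedSquare])
  have hne : openSquare.domain ≠ closedSquare.domain := by
    intro hEq
    rw [openSquare_domain, closedSquare_domain] at hEq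
    exact zero_not_mem_openSquareSet (hEq ▸ zero_mem_closedSquareSet)
  obtain ⟨Φ, Φ', -, hderiv, -, hdom, hjac⟩ := exists_witness_of_mem_changeOfVariablesRel hne hmem
  rw [openSquare_domain, closedSquare_domain] at hdom
  simp only [openSquare_domain, openSquare_integrand, closedSquare_integrand, one_mul] at hderiv hjac
  -- a preimage of the corner `0`
  obtain ⟨x₀, hx₀S, hx₀⟩ : (0 : Fin 2 → ℝ) ∈ Φ '' openSquareSet := hdom ▸ zero_mem_closedSquareSet
  have hS : openSquareSet ∈ 𝓝 x₀ := isOpen_openSquareSet.mem_nhds hx₀S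
  have hΦ : HasFDerivAt Φ (Φ' x₀) x₀ := (hderiv x₀ hx₀S).hasFDerivAt hS
  have hf : HasFDerivAt (fun x => Φ x 0) ((ContinuousLinearMap.proj 0).comp (Φ' x₀)) x₀ :=
    hasFDerivAt_pi'.1 hΦ 0
  have hmin : IsLocalMin (fun x => Φ x 0) x₀ := by
    show ∀ᶠ x in 𝓝 x₀, Φ x₀ 0 ≤ Φ x 0
    filter_upwards [hS] with x hx
    have hxT : Φ x ∈ closedSquareSet := hdom ▸ mem_image_of_mem Φ hx
    rw [hx₀]
    exact hxT.1
  have hzero := hmin.hasFDerivAt_eq_zero hf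
  -- `det DΦ(x₀) ≠ 0`
  have hdet : (Φ' x₀).det ≠ 0 := by
    intro h0
    have := hjac x₀ hx₀S
    rw [h0, abs_zero] at this
    exact one_ne_zero this
  have hsurj : Function.Surjective ((Φ' x₀ : (Fin 2 → ℝ) →ₗ[ℝ] (Fin 2 → ℝ))) := by
    have hu : IsUnit ((Φ' x₀ : (Fin 2 → ℝ) →ₗ[ℝ] (Fin 2 → ℝ))) :=
      (LinearMap.isUnit_iff_isUnit_det _).mpr (isUnit_iff_ne_zero.mpr hdet)
    exact LinearMap.range_eq_top.mp ((LinearMap.isUnit_iff_range_eq_top _).mp hu)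
  obtain ⟨v, hv⟩ := hsurj (Pi.single 0 1)
  have := DFunLike.congr_fun hzero v
  rw [ContinuousLinearMap.comp_apply] at this
  change (Φ' x₀ v) 0 = 0 at this
  rw [ContinuousLinearMap.coe_coe] at hv
  rw [hv] at this
  simp at this

/-! ### §3b Additivity alone does not suffice: a map or a Newton–Leibniz move is needed

The tree's window invariant `KZ.restrictedEval` (integrate over `domain ∩ (0,1)ⁿ` only) kills the
two additivity moves (`KZ.closure_add_le_ker_restrictedEval`) and separates the unit square from
its translate by `(2, 0)`.  (Trivial, but it is the formal statement that rules 1a/1b alone do not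
act transitively on equal-area regions: every chain for the crux contains a rule-2 or rule-3 move.) -/

/-- The translated open unit square `(2,3) × (0,1)`. -/
def shiftedSquareSet : Set (Fin 2 → ℝ) := {p | 2 < p 0 ∧ p 0 < 3 ∧ 0 < p 1 ∧ p 1 < 1}

/-- The translated square as a product of intervals. -/
theorem shiftedSquareSet_eq_pi :
    shiftedSquareSet = Set.pi univ fun i : Fin 2 => Ioo ((![2, 0] : Fin 2 → ℝ) i) (![3, 1] i) := by
  ext p
  simp [shiftedSquareSet, Fin.forall_fin_two, and_assoc]

/-- The translated square is `ℚ`-semialgebraic. -/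
theorem isSemialgebraic_shiftedSquareSet : IsSemialgebraic ℚ shiftedSquareSet := by
  have h0 := isSemialgebraic_setOf_eval_lt (k := ℚ) (R := ℝ) (ι := Fin 2) (C 2) (X 0)
  have h1 := isSemialgebraic_setOf_eval_lt (k := ℚ) (R := ℝ) (ι := Fin 2) (X 0) (C 3)
  have h2 := isSemialgebraic_setOf_eval_lt (k := ℚ) (R := ℝ) (ι := Fin 2) (C 0) (X 1)
  have h3 := isSemialgebraic_setOf_eval_lt (k := ℚ) (R := ℝ) (ι := Fin 2) (X 1) (C 1)
  have hEq : shiftedSquareSet =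
      {x : Fin 2 → ℝ | aeval x (C 2 : MvPolynomial (Fin 2) ℚ) < aeval x (X 0 : MvPolynomial (Fin 2) ℚ)} ∩
      ({x : Fin 2 → ℝ | aeval x (X 0 : MvPolynomial (Fin 2) ℚ) < aeval x (C 3 : MvPolynomial (Fin 2) ℚ)} ∩
      ({x : Fin 2 → ℝ | aeval x (C 0 : MvPolynomial (Fin 2) ℚ) < aeval x (X 1 : MvPolynomial (Fin 2) ℚ)} ∩
      {x : Fin 2 → ℝ | aeval x (X 1 : MvPolynomial (Fin 2) ℚ) < aeval x (C 1 : MvPolynomial (Fin 2) ℚ)})) := by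
    ext p
    simp [shiftedSquareSet]
  rw [hEq]
  exact h0.inter (h1.inter (h2.inter h3))

/-- The translated square has area `1`. -/
theorem volume_shiftedSquareSet : volume shiftedSquareSet = 1 := by
  rw [shiftedSquareSet_eq_pi, Real.volume_pi_Ioo]
  norm_num [Fin.prod_univ_two]

/-- `[(2,3) × (0,1), 1]`. -/
def shiftedSquare : KZ.IntegralRep 2 :=
  constOneRep shiftedSquareSet isSemialgebraic_shiftedSquareSet (by simp [volume_shiftedSquareSet])

/-- The domain of `shiftedSquare`. -/
@[simp] theorem shiftedSquare_domain : shiftedSquare.domain = shiftedSquareSet := rfl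
/-- The integrand of `shiftedSquare`. -/
@[simp] theorem shiftedSquare_integrand : shiftedSquare.integrand = fun _ => 1 := rfl

/-- `[(2,3)×(0,1), 1]` has value `1`. -/
theorem value_shiftedSquare : shiftedSquare.value = 1 := by
  rw [shiftedSquare, value_constOneRep, volume_shiftedSquareSet, ENNReal.toReal_one]

/-- STRENGTHENING: chains of additivity moves (1a)/(1b) only. -/
def AdditivityOnly : Prop :=
  ∀ (r r' : KZ.IntegralRep 2), (∀ p ∈ r.domain, r.integrand p = 1) →
    (∀ p ∈ r'.domain, r'.integrand p = 1) → r.value = r'.value →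
    KZ.of r - KZ.of r' ∈ AddSubgroup.closure (KZ.domainAddRel ∪ KZ.integrandAddRel)

/-- **Additivity alone is not enough**: `[(0,1)²]` and its translate `[(2,3)×(0,1)]` have equal
area but different restricted value over the window `(0,1)²` (`1` versus `0`), an invariant of the
additivity moves (`KZ.closure_add_le_ker_restrictedEval`). -/
theorem not_additivityOnly : ¬ AdditivityOnly := by
  intro h
  have hmem := h openSquare shiftedSquare (fun _ _ => rfl) (fun _ _ => rfl)
    (by rw [value_openSquare, value_shiftedSquare])
  let A : (n : ℕ) → Set (Fin n → ℝ) := fun n => Set.pi univ fun _ : Fin n => Ioo (0:ℝ) 1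
  have hA : ∀ n, MeasurableSet (A n) := fun n =>
    MeasurableSet.univ_pi fun _ => measurableSet_Ioo
  have hker := KZ.closure_add_le_ker_restrictedEval A hA hmem
  have h1 : openSquare.domain ∩ A 2 = openSquare.domain := by
    rw [openSquare_domain, openSquareSet_eq_pi, inter_self]
  have h2 : shiftedSquare.domain ∩ A 2 = ∅ := by
    ext p
    simp only [shiftedSquare_domain, mem_inter_iff, mem_empty_iff_false, iff_false, not_and]
    intro hp hA2
    have h0 : p 0 ∈ Ioo (0:ℝ) 1 := by simpa [A] using hA2 0 (mem_univ _)
    exact absurd hp.1 (by linarith [h0.2])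
  rw [AddMonoidHom.mem_ker, map_sub, KZ.restrictedEval_of, KZ.restrictedEval_of, h1, h2,
    Measure.restrict_empty, integral_zero_measure, sub_zero] at hker
  have hv : openSquare.value = 0 := hker
  rw [value_openSquare] at hv
  exact one_ne_zero hv

end Summit.KontsevichZagierPeriods.PlanarAreas.Negative

end
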